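import Summits.BirchSwinnertonDyer.BirchSwinnertonDyer.Theorems.CMKolyvaginAtInertTwoPointSystemAtTwoOfPrintedInputs
import Summits.BirchSwinnertonDyer.BirchSwinnertonDyer.Theorems.CMKolyvaginAtInertTwoAnnihilatorUncondAtTwoPow
import Summits.BirchSwinnertonDyer.BirchSwinnertonDyer.Theorems.CMKolyvaginAtInertTwoReciprocityFamilyAtTwo
import Summits.BirchSwinnertonDyer.BirchSwinnertonDyer.Theorems.CMKolyvaginAtInertTwoRestrictionInjectiveAtTwo
import Summits.BirchSwinnertonDyer.Rank1Residual.P2.CMKolyvaginCartanCommuteAtTwoClasses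
import Summits.BirchSwinnertonDyer.Rank1Residual.X11b.KolyvaginLeafInputsDischarged
import HarnessLib

/-!
# Route `CMKolyvaginAtInertTwo`, crux `CMKolyvaginExactAtInertTwo` (stmt-BirchSwinnertonDyer-24277):
# KOLYVAGIN'S ANNIHILATOR AT `p = 2` ON H₂ MODULO PRINT — g7's `exists_two_pow_smul_eq_zsmul_uncond` with
# its DATA binders (point system, reciprocity) and its Cartan binder `hcomm` DISCHARGED

Seat `bsd-line-cmk2-p1` g9 (cell `bsd-print-cf2`); helper (`--supports stmt-BirchSwinnertonDyer-24277`).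
THEOREMS ONLY (no definition, no named fact, no instance, no `sorry`); no item is closed; BSD is not
proved by this.

g7's `KolyvaginDescentTwo.exists_two_pow_smul_eq_zsmul_uncond` (p625327): at level `2^M` with
`ord δy_K = 2^{a+1}` exactly, **`2^{2(M−a)}·s ∈ ℤ·δ(y_K)` for EVERY `s ∈ Sel_{2^M}(E/K)`** — Kolyvagin's
theorem AT `2` as an annihilator — modulo (i) ty2's point-system and reciprocity DATA with full support, (ii)
the Cartan binders `hzfix`/`hcomm`, (iii) the sign `ε` of `y_K` (Gross 5.3 at `m = 1`). On H₂ all three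
are now theorems modulo print: (i) `CMPointSystemTwo.nonempty_pointSystemFamily_two_of_cmInert_of_printedInputs`
(this seat, p638266: modulo the named fact Gross 3.7 (2), the printed GZ III (3.1), and Gross 5.3 — the
last DISCHARGED by x11b3's `X11b.KolyvaginLeaves.h53_holds`) and `KolyvaginReciprocityTwo.nonempty_reciprocityFamily_two_top`
(p634537); (ii) `KolyvaginImageTwo.exists_smul_three_of_hasSurjectiveModNGaloisRep` (g3) +
`CartanAtTwo.hcomm_of_habitat` (ty2 g21, p628421); (iii) the field `conj_sub_torsion` of the point system.

* `exists_two_pow_smul_eq_zsmul_of_cmInert_of_printedInputs` — ON H₂ (`HasCM`, `CMInert W 2`, `ρ̄₂`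
  onto, globally minimal), `K` imaginary quadratic with odd `d_K ≠ −3` and Heegner for `N_E`, conjugation
  `c ≠ 1`, `P` a Heegner point of level `N_E` of infinite order with `2^{a+1} P ∈ 2^M E(K)`,
  `2^a P ∉ 2^M E(K)` (`a < M`, `1 ≤ M`): GIVEN the named fact `prop37_2_reductionCongruence_inert N_E W K`
  and the printed `hGZ31`, **for every `s ∈ Sel_{2^M}(E/K)` there is `r` with
  `2^{(M−a)+(M−a−1)+1}·s = r·δ(P)`**.

HONEST FRAMING: composition; conditional on the displayed prints; beyond print: the STATEMENT (Kolyvagin's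
annihilator at `p = 2` for CM curves with `2` inert) has no printed counterpart (Kolyvagin 1989 Thm. B excludes
`p = 2`; barrier `CMRankOneAtNonsplitTwo`) — no new mathematics is claimed beyond g2–g8's kernel port. BSD
is not proved by this.

References: [Kolyvagin1989Izv] Thm. B, §3; [GrossLMS1991] §§3–6, §10; [McCallumLMS1991] §§4–5;
[GrossZagier1986] III (3.1); [Lang1987] Ch. 13 §4 Thm. 12.
-/

-- single-conjunct summit: `Summit.BirchSwinnertonDyer.BirchSwinnertonDyer.…` repeats the name by design
set_option linter.dupNamespace false
set_option autoImplicit false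

noncomputable section

open scoped Classical
open WeierstrassCurve Field NumberField IsDedekindDomain Finset
open Literature.NumberTheory.EllipticCurves Literature.NumberTheory.GaloisRepresentations
open Literature.NumberTheory.EllipticCurves.KolyvaginCocycle
open Literature.NumberTheory.EllipticCurves.RingClassField
open Literature.NumberTheory.EllipticCurves.ModularForms
open Literature.NumberTheory.EllipticCurves.Rank1Residual (CMInert)
open Summit.BirchSwinnertonDyer.Rank1Residual.X11b

namespace Summit.BirchSwinnertonDyer.BirchSwinnertonDyer.Theorems.KolyvaginDescentTwo

-- `K : Type`: the tree's ring-class class field theory is universe `0`.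
variable (W : WeierstrassCurve ℚ) {K : Type} [Field K] [NumberField K]

/-- **KOLYVAGIN'S ANNIHILATOR AT `p = 2` ON H₂, MODULO PRINT** (module docstring): level `2^M`, `a < M`
with `2^{a+1} P ∈ 2^M E(K)` and `2^a P ∉ 2^M E(K)`; every `s ∈ Sel_{2^M}(E/K)` satisfies
`2^{(M−a)+(M−a−1)+1}·s ∈ ℤ·δ(P)`. [cite: Kolyvagin1989Izv, Thm. B and §3] [cite: GrossLMS1991, §10 and
Props. 3.7, 5.3, 6.2] [cite: McCallumLMS1991, §5] [cite: GrossZagier1986, III (3.1)] -/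
theorem exists_two_pow_smul_eq_zsmul_of_cmInert_of_printedInputs [W.IsElliptic] [W.IsGloballyMinimal]
    [NeZero (W.conductorNorm ℤ)] (hCM : W.HasCM) (hin : CMInert W 2)
    (hsurj : W.HasSurjectiveModNGaloisRep 2) (hK : IsImaginaryQuadratic K)
    (hodd : Odd (NumberField.discr K)) (h3 : NumberField.discr K ≠ -3)
    (hH : SatisfiesHeegnerHypothesis (W.conductorNorm ℤ) K) {P : (W.baseChange K).toAffine.Point}
    (hP : IsHeegnerPoint (W.conductorNorm ℤ) W K P) (hnt : ¬ IsOfFinAddOrder P)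
    {c : K ≃ₐ[ℚ] K} (hc : c ≠ 1) {M : ℕ} (hM : 1 ≤ M) {a : ℕ} (ha : a < M)
    (hy : ∀ Q : (W.baseChange K).toAffine.Point, ((2 ^ M : ℕ) : ℤ) • Q ≠ ((((2 : ℕ) : ℤ) ^ a)) • P)
    (hye : ∃ Q : (W.baseChange K).toAffine.Point,
      ((2 ^ M : ℕ) : ℤ) • Q = ((((2 : ℕ) : ℤ) ^ (a + 1))) • P)
    (h372 : GrossLMS1991.prop37_2_reductionCongruence_inert (W.conductorNorm ℤ) W K)
    (hGZ31 : ∀ [W.IsElliptic] (_hK : IsImaginaryQuadratic K) (_hH : SatisfiesHeegnerHypothesis (W.conductorNorm ℤ) K)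
      (Dt : ModularParametrizationData W (W.conductorNorm ℤ)) (β : ℤ) (ι : K →+* ℂ) {M : ℕ} (_hM : 1 ≤ M) {n : ℕ}
      (_hn : Squarefree n)
      (_hKol : ∀ q ∈ n.primeFactors, IsKolyvaginPrime (W.conductorNorm ℤ) W K 2 q ∧ FrobEqFrobInfty W K (2 ^ M) q)
      (d : (m : ℕ) → m ∣ n → KolyvaginHeegnerData Dt β ι m),
      ∃ n' : ℤ, IsCoprime ((2 ^ M : ℕ) : ℤ) n' ∧
        ∀ (m : ℕ) (hm : m ∣ n) (γ : ringClassField K ι m ≃ₐ[ℚ] ringClassField K ι m),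
          γ ∈ ringClassGal ι m → ∀ v : HeightOneSpectrum (𝓞 K),
            ¬ (W.baseChange K).HasGoodReductionAt v →
            n' • pointsMap (W.baseChange K) (v.adicCompletion K)
                ((d m hm).toGeomPoints (pointGalHom W (ringClassField K ι m) γ (d m hm).y)) ∈
              E0Receptacle (W.baseChange K) v ∧
            ∀ (ℓ : ℕ) (hℓ : ℓ ∈ m.primeFactors)
              (hle : ringClassField K ι (m / ℓ) ≤ ringClassField K ι m),
              n' • pointsMap (W.baseChange K) (v.adicCompletion K)
                  ((d m hm).toGeomPoints (pointGalHom W (ringClassField K ι m) γ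
                    (WeierstrassCurve.Affine.Point.map (W' := W)
                      ((RingClassField.inclusion ι hle).restrictScalars ℚ)
                      (d (m / ℓ)
                        ((Nat.div_dvd_of_dvd (Nat.dvd_of_mem_primeFactors hℓ)).trans hm)).y))) ∈
                E0Receptacle (W.baseChange K) v)
    (hdiv : ∀ Q : geomPoints (W.baseChange K), ∃ R, ((2 ^ M : ℕ) : ℤ) • R = Q)
    {s : galH1Torsion (W.baseChange K) ((2 ^ M : ℕ) : ℤ)}
    (hs : s ∈ selmerGroup (W.baseChange K) ((2 ^ M : ℕ) : ℤ)) :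
    ∃ r : ℤ, (((2 : ℕ) : ℤ) ^ ((M - a) + (M - a - 1) + 1)) • s =
      r • kummerMapTorsion (W.baseChange K) _ hdiv P := by
  have hΔ : W.Δ < 0 := KolyvaginEigenTwo.Δ_neg_of_cmInert_two W hCM hin hsurj
  have hΔK : ¬ IsSquare (W.baseChange K).Δ := by
    have h : (W.baseChange K).Δ = algebraMap ℚ K W.Δ := by rw [baseChange, map_Δ]
    rw [h]
    exact KolyvaginImageTwo.not_isSquare_algebraMap_Δ_of_cmInert_two_of_heegner W hCM hin hsurj K hK hH
  -- the Cartan element `z` (fixed-point-free on `E[2]`) and the commutation `hcomm` on H₂ (ty2 g21)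
  obtain ⟨z, -, hzfix⟩ := KolyvaginImageTwo.exists_smul_three_of_hasSurjectiveModNGaloisRep W K hK.1 hsurj
  have hcomm := Rank1Residual.P2.CartanAtTwo.hcomm_of_habitat W K hCM hin hsurj (M := M) hzfix
  -- the two DATA families, now theorems modulo print
  obtain ⟨D⟩ := CMPointSystemTwo.nonempty_pointSystemFamily_two_of_cmInert_of_printedInputs
    (N := W.conductorNorm ℤ) rfl hCM hin hsurj hK hodd h3 hH hP h372 (KolyvaginLeaves.h53_holds rfl 2)
    hGZ31 (fun _ ↦ True)
  obtain ⟨R⟩ := KolyvaginReciprocityTwo.nonempty_reciprocityFamily_two_top W K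
  -- the sign `ε` of `P` from the package at level `M`
  have hε := (D hM hdiv c hc).hε
  have hPε := (D hM hdiv c hc).conj_sub_torsion
  exact exists_two_pow_smul_eq_zsmul_uncond W hK hP hnt hsurj hΔ hΔK hc hM hzfix hcomm ha hy hye hε hPε
    D R hdiv hs

end Summit.BirchSwinnertonDyer.BirchSwinnertonDyer.Theorems.KolyvaginDescentTwo

end
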